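import Literature.NumberTheory.DiophantineGeometry.AVIsogenyTateHomProofs
import HarnessLib

/-!
# Step I of Mumford §19, Theorem 3 from a separating family of positive quadratic forms

Pure algebra behind the Poincaré-free proof of the finite generation of `Hom(A, B)`
(`AVIsogenyTateHomPositivityProofs`). Let `H` be an abelian group.

* `IsPositiveForm N B` — `N : H → ℤ` and a symmetric biadditive `B` with `2 N(f) = B(f, f)` and
  `N ≥ 0` (a positive semi-definite integral quadratic form and its polar form); consequences
  `N(f + g) = N f + N g + B(f, g)`, `N(n f) = n² N(f)`, and **`N(f) = N(g) = 0 ⇒ B(f, g) = 0`**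
  (`polar_eq_zero`), so that the null space `{N = 0}` is a saturated subgroup (`nullSubmodule`).
* Given a family `(N_i, B_i)` of positive forms which **separates**: every `f ≠ 0` has `N_i(f) ≥ 1`
  for some `i` —
  `noZeroSMulDivisors_of_isPositiveForm`: `H` is torsion-free;
  `exists_finset_forall_one_le`: on a finitely generated `M ≤ H` finitely many `N_i` already
  separate (rank argument on the saturated subgroups `M ∩ ⋂ Null(N_i)`);
  `exists_fg_of_isPositiveForm`: **the saturation of every finitely generated `M ≤ H` lies in a
  finitely generated subgroup** — Step I of the printed proof of Mumford §19 Thm. 3 / Milne 1986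
  Thm. 12.5 (there for `End(X)`, `X` simple, with `N = deg`; positivity of the forms replaces the
  simplicity of `X`, i.e. Poincaré's reducibility theorem), by the discreteness lemma `fg_of_norm` of
  `AVIsogenyTateHomProofs` with `N = Σ_{i ∈ s} N_i` and the real quadratic polynomial
  `F(t) = ½ Σ_i Σ_{j,l} t_j t_l B_i(b_j, b_l)`.

No definitions of geometric content, no named facts.

## References

* [MumfordAV1970] D. Mumford, *Abelian Varieties*, §19, Thm. 3, proof, first step (pp. 176–177 of the
  2nd ed.). Not held; architecture as in Milne 1986.
* [Milne1986AbelianVarieties] J. S. Milne, *Abelian Varieties*, in Cornell–Silverman (eds.),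
  *Arithmetic Geometry* (1986): Lemma 12.7 and its proof, statement (*) (held:
  `book:cornellnd-arithmetic-geometry`, PDF p. 191).
-/

open scoped BigOperators

noncomputable section

namespace Literature.NumberTheory.DiophantineGeometry

section PositiveForms

variable {H : Type*} [AddCommGroup H] {ι : Type*}

/-- **A positive form** on an abelian group `H`: an integer-valued function `N` together with a
symmetric biadditive `B` such that `2 N(f) = B(f, f)` and `N ≥ 0` — i.e. `N` is a positive
semi-definite integral quadratic form with polar form `B` (`B(f, g) = N(f + g) - N(f) - N(g)`).
The curve forms `N_{c,L}` on `Hom(A, B)` of `Motives/AbelianVarietyHomCurveForm` are such.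
[folklore] -/
structure IsPositiveForm (N : H → ℤ) (B : H →+ H →+ ℤ) : Prop where
  /-- `2 N(f) = B(f, f)`. -/
  two_mul_eq : ∀ f, 2 * N f = B f f
  /-- `B` is symmetric. -/
  symm : ∀ f g, B f g = B g f
  /-- `N ≥ 0`. -/
  nonneg : ∀ f, 0 ≤ N f

namespace IsPositiveForm

variable {N : H → ℤ} {B : H →+ H →+ ℤ} (h : IsPositiveForm N B)
include h

/-- `N(f + g) = N(f) + N(g) + B(f, g)`. [folklore] -/
theorem apply_add (f g : H) : N (f + g) = N f + N g + B f g := by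
  have h1 := h.two_mul_eq (f + g)
  simp only [map_add, AddMonoidHom.add_apply] at h1
  rw [h.symm g f] at h1
  have h2 := h.two_mul_eq f
  have h3 := h.two_mul_eq g
  linarith

/-- `N(0) = 0`. [folklore] -/
theorem apply_zero : N 0 = 0 := by
  have h1 := h.two_mul_eq 0
  simp only [map_zero] at h1
  linarith

/-- `N(-f) = N(f)`. [folklore] -/
theorem apply_neg (f : H) : N (-f) = N f := by
  have h1 := h.two_mul_eq (-f)
  simp only [map_neg, AddMonoidHom.neg_apply, neg_neg] at h1
  have h2 := h.two_mul_eq f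
  linarith

/-- `N(n f) = n² N(f)`. [folklore] -/
theorem apply_zsmul (n : ℤ) (f : H) : N (n • f) = n ^ 2 * N f := by
  have h1 := h.two_mul_eq (n • f)
  simp only [map_zsmul, AddMonoidHom.smul_apply, smul_eq_mul] at h1
  have h2 := h.two_mul_eq f
  have h3 : 2 * N (n • f) = n ^ 2 * (2 * N f) := by rw [h1, h2]; ring
  linarith

/-- **`N(f) = N(g) = 0` forces `B(f, g) = 0`** (`N ≥ 0`: `0 ≤ N(f ± g) = ± B(f, g)`). [folklore] -/
theorem polar_eq_zero (f g : H) (hf : N f = 0) (hg : N g = 0) : B f g = 0 := by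
  have h1 := h.apply_add f g
  have h2 := h.apply_add f (-g)
  rw [h.apply_neg g] at h2
  simp only [map_neg] at h2
  rw [hf, hg] at h1 h2
  have h3 := h.nonneg (f + g)
  have h4 := h.nonneg (f + -g)
  linarith

/-- **The null space `{f | N(f) = 0}` of a positive form is a subgroup** (a `ℤ`-submodule).
[folklore] -/
def nullSubmodule : Submodule ℤ H where
  carrier := {f | N f = 0}
  add_mem' {f g} hf hg := by
    change N (f + g) = 0
    rw [h.apply_add, hf, hg, h.polar_eq_zero f g hf hg]; rfl
  zero_mem' := h.apply_zero
  smul_mem' n f hf := by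
    change N (n • f) = 0
    rw [h.apply_zsmul, hf, mul_zero]

/-- Membership in the null space. [folklore] -/
@[simp] theorem mem_nullSubmodule {f : H} : f ∈ h.nullSubmodule ↔ N f = 0 := Iff.rfl

/-- The null space is saturated: `N(n f) = n² N(f) = 0`, `n ≠ 0` ⇒ `N(f) = 0`. [folklore] -/
theorem mem_nullSubmodule_of_zsmul_mem {n : ℤ} (hn : n ≠ 0) {f : H} (hf : n • f ∈ h.nullSubmodule) :
    f ∈ h.nullSubmodule := by
  rw [mem_nullSubmodule] at hf ⊢
  rw [h.apply_zsmul] at hf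
  exact (mul_eq_zero.mp hf).resolve_left (pow_ne_zero 2 hn)

/-- `1 ≤ N(f)` iff `N(f) ≠ 0`. [folklore] -/
theorem one_le_iff_ne_zero {f : H} : 1 ≤ N f ↔ N f ≠ 0 := by
  have := h.nonneg f
  omega

/-- If `1 ≤ N(n f)` with `n ≠ 0` then `1 ≤ N(f)`. [folklore] -/
theorem one_le_of_one_le_zsmul {n : ℤ} {f : H} (hf : 1 ≤ N (n • f)) : 1 ≤ N f := by
  rw [h.one_le_iff_ne_zero] at hf ⊢
  intro h0
  apply hf
  rw [h.apply_zsmul, h0, mul_zero]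

end IsPositiveForm

/-! ### A separating family of positive forms -/

variable {N : ι → H → ℤ} {B : ι → H →+ H →+ ℤ} (hNB : ∀ i, IsPositiveForm (N i) (B i))
  (hsep : ∀ f : H, f ≠ 0 → ∃ i, 1 ≤ N i f)
include hNB hsep

/-- **A separating family of positive forms forces `H` to be torsion-free**: `n f = 0`, `n ≠ 0`,
`f ≠ 0` and `1 ≤ N_i(f)` give `1 ≤ n² N_i(f) = N_i(n f) = N_i(0) = 0`. (Cf. Mumford §19 Thm. 3:
`Hom(X, Y)` is torsion-free.) [folklore] -/
theorem noZeroSMulDivisors_of_isPositiveForm : NoZeroSMulDivisors ℤ H := by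
  refine ⟨fun {n f} hnf => ?_⟩
  by_contra hc
  obtain ⟨hn, hf⟩ := not_or.1 hc
  obtain ⟨i, hi⟩ := hsep f hf
  have h1 := (hNB i).apply_zsmul n f
  rw [hnf, (hNB i).apply_zero] at h1
  have h3 : 1 ≤ n ^ 2 := by nlinarith [sq_nonneg n, Int.one_le_abs hn, sq_abs n]
  nlinarith

/-- **Finitely many forms of a separating family already separate the nonzero elements of a
finitely generated subgroup `M`.** For a finite set `s` of indices let `V_s = M ∩ ⋂_{i ∈ s} Null(N_i)`,
a saturated subgroup of the free finitely generated `M`; if `0 ≠ f ∈ V_s` and `1 ≤ N_{i₀}(f)`, then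
`V_{s ∪ {i₀}} ⊊ V_s` has strictly smaller rank (a saturated proper subgroup), so a set `s` with `V_s`
of minimal rank has `V_s = 0`. [folklore] -/
theorem exists_finset_forall_one_le (M : Submodule ℤ H) (hM : M.FG) :
    ∃ s : Finset ι, ∀ f ∈ M, f ≠ 0 → ∃ i ∈ s, 1 ≤ N i f := by
  classical
  haveI : NoZeroSMulDivisors ℤ H := noZeroSMulDivisors_of_isPositiveForm hNB hsep
  haveI : Module.Finite ℤ M := Module.Finite.iff_fg.2 hM
  -- `V s = M ∩ ⋂_{i ∈ s} Null(N i)`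
  let V : Finset ι → Submodule ℤ H := fun s => M ⊓ ⨅ i ∈ s, (hNB i).nullSubmodule
  have hVM : ∀ s, V s ≤ M := fun s => inf_le_left
  have hVmem : ∀ s f, f ∈ V s ↔ f ∈ M ∧ ∀ i ∈ s, N i f = 0 := fun s f => by
    simp only [V, Submodule.mem_inf, Submodule.mem_iInf, IsPositiveForm.mem_nullSubmodule]
  have hVfg : ∀ s, (V s).FG := fun s => by
    have hfg := (IsNoetherian.noetherian (R := ℤ) (M := M) ((V s).comap M.subtype)).map M.subtype
    rwa [Submodule.map_comap_subtype, inf_eq_right.2 (hVM s)] at hfg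
  -- a set `s₀` with `V s₀` of minimal rank
  have hex : ∃ n, ∃ s, Module.finrank ℤ (V s) = n := ⟨_, ∅, rfl⟩
  obtain ⟨s₀, hs₀⟩ := Nat.find_spec hex
  have hmin : ∀ s, Module.finrank ℤ (V s₀) ≤ Module.finrank ℤ (V s) := fun s => by
    rw [hs₀]; exact Nat.find_min' hex ⟨s, rfl⟩
  refine ⟨s₀, fun f hfM hf0 => ?_⟩
  by_contra hno
  simp only [not_exists, not_and, not_le] at hno
  have hfV : f ∈ V s₀ := (hVmem s₀ f).2 ⟨hfM, fun i hi => by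
    have := (hNB i).nonneg f; have := hno i hi; omega⟩
  obtain ⟨i₀, hi₀⟩ := hsep f hf0
  let s₁ := insert i₀ s₀
  have hle : V s₁ ≤ V s₀ := fun g hg => by
    rw [hVmem] at hg ⊢
    exact ⟨hg.1, fun i hi => hg.2 i (Finset.mem_insert_of_mem hi)⟩
  have hfV₁ : f ∉ V s₁ := fun hf => by
    have := ((hVmem s₁ f).1 hf).2 i₀ (Finset.mem_insert_self _ _)
    omega
  -- `V s₁` is free with a finite basis; `f` and that basis are independent in `V s₀`
  haveI : Module.Finite ℤ (V s₁) := Module.Finite.iff_fg.2 (hVfg s₁)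
  haveI : Module.Finite ℤ (V s₀) := Module.Finite.iff_fg.2 (hVfg s₀)
  haveI : Module.Free ℤ (V s₁) := Module.free_of_finite_type_torsion_free'
  set r := Module.finrank ℤ (V s₁) with hr
  let b : Module.Basis (Fin r) ℤ (V s₁) := Module.finBasis ℤ (V s₁)
  -- the family `Fin (r + 1) → V s₀`: `f` and the `b j`
  let v : Fin (r + 1) → V s₀ := Fin.cons ⟨f, hfV⟩ fun j => ⟨(b j : H), hle (b j).2⟩
  have hv : ¬ LinearIndependent ℤ v := fun hv => by
    have h1 := hv.fintype_card_le_finrank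
    rw [Fintype.card_fin] at h1
    have h2 := hmin s₁
    omega
  rw [Fintype.not_linearIndependent_iff] at hv
  obtain ⟨g, hg, j, hj⟩ := hv
  -- the relation `g 0 • f + Σ g (succ j) • b j = 0`
  rw [Fin.sum_univ_succ] at hg
  have hg' : g 0 • f + ∑ j : Fin r, g j.succ • (b j : H) = 0 := by
    have := congrArg (fun x : V s₀ => (x : H)) hg
    simpa [v] using this
  by_cases hg0 : g 0 = 0
  · -- then the basis `b` is dependent
    rw [hg0, zero_smul, zero_add] at hg'
    have hb : LinearIndependent ℤ (fun j => (b j : H)) :=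
      b.linearIndependent.map' (V s₁).subtype (Submodule.ker_subtype _)
    have hcoef : ∀ j', g (Fin.succ j') = 0 := fun j' =>
      Fintype.linearIndependent_iff.mp hb (fun j => g j.succ) hg' j'
    rcases Fin.eq_zero_or_eq_succ j with rfl | ⟨j', rfl⟩
    · exact hj hg0
    · exact hj (hcoef j')
  · -- then `g 0 • f ∈ V s₁`, so `f ∈ V s₁` by saturation: contradiction
    have hmem : g 0 • f ∈ V s₁ := by
      have : g 0 • f = - ∑ j : Fin r, g j.succ • (b j : H) := eq_neg_of_add_eq_zero_left hg'
      rw [this]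
      exact (V s₁).neg_mem ((V s₁).sum_mem fun j _ => (V s₁).smul_mem _ (b j).2)
    apply hfV₁
    rw [hVmem] at hmem ⊢
    refine ⟨hfM, fun i hi => ?_⟩
    have := (hNB i).mem_nullSubmodule_of_zsmul_mem hg0 (f := f) (by
      rw [IsPositiveForm.mem_nullSubmodule]; exact hmem.2 i hi)
    rwa [IsPositiveForm.mem_nullSubmodule] at this

/-- **Step I of Mumford's proof of §19 Thm. 3 from a separating family of positive forms.** Let
`H` carry positive forms `(N_i, B_i)` such that every `f ≠ 0` has `N_i(f) ≥ 1` for some `i`. Then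
the saturation `{φ | n φ ∈ M, some n ≠ 0}` of every finitely generated subgroup `M ≤ H` lies in
(indeed is) a finitely generated subgroup. Proof: `H` is torsion-free
(`noZeroSMulDivisors_of_isPositiveForm`), `M` is free with a finite basis `b`; finitely many forms
`N_i`, `i ∈ s`, separate `M ∖ 0` (`exists_finset_forall_one_le`), hence also the saturation
(`N(n φ) = n² N(φ)`); and `N = Σ_{i ∈ s} N_i` is, in the rational coordinates of `φ`, the real
quadratic polynomial `F(t) = ½ Σ_i Σ_{j,l} t_j t_l B_i(b_j, b_l)`, continuous with `F(0) = 0 < 1`,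
so the discreteness lemma `fg_of_norm` (Milne 1986, proof of Lemma 12.7) applies. In the source the
form is `deg` on `End(X)` for `X` simple; here positivity replaces simplicity.
[cite: Milne1986AbelianVarieties, Lemma 12.7 (proof, statement (*), PDF p. 191)] -/
theorem exists_fg_of_isPositiveForm (M : Submodule ℤ H) (hM : M.FG) :
    ∃ S : Submodule ℤ H, S.FG ∧ ∀ φ : H, (∃ n : ℤ, n ≠ 0 ∧ n • φ ∈ M) → φ ∈ S := by
  classical
  haveI : NoZeroSMulDivisors ℤ H := noZeroSMulDivisors_of_isPositiveForm hNB hsep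
  haveI : Module.Finite ℤ M := Module.Finite.iff_fg.2 hM
  haveI : Module.Free ℤ M := Module.free_of_finite_type_torsion_free'
  set r := Module.finrank ℤ M with hr
  let b : Module.Basis (Fin r) ℤ M := Module.finBasis ℤ M
  obtain ⟨s, hs⟩ := exists_finset_forall_one_le hNB hsep M hM
  -- the saturation of `M`
  let S : Submodule ℤ H :=
    { carrier := {f | ∃ n : ℤ, n ≠ 0 ∧ n • f ∈ M}
      add_mem' := by
        rintro f g ⟨n, hn, hf⟩ ⟨m, hm, hg⟩
        refine ⟨m * n, mul_ne_zero hm hn, ?_⟩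
        rw [smul_add]
        refine M.add_mem ?_ ?_
        · rw [mul_smul]; exact M.smul_mem m hf
        · rw [mul_comm, mul_smul]; exact M.smul_mem n hg
      zero_mem' := ⟨1, one_ne_zero, by rw [smul_zero]; exact M.zero_mem⟩
      smul_mem' := by
        rintro c f ⟨n, hn, hf⟩
        exact ⟨n, hn, by rw [smul_comm]; exact M.smul_mem c hf⟩ }
  have hSmem : ∀ f : H, f ∈ S ↔ ∃ n : ℤ, n ≠ 0 ∧ n • f ∈ M := fun f => Iff.rfl
  refine ⟨S, ?_, fun φ hφ => (hSmem φ).2 hφ⟩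
  -- the norm `N = Σ_{i ∈ s} N i` and its coordinate polynomial `F`
  let Nsum : H → ℤ := fun f => ∑ i ∈ s, N i f
  let F : (Fin r → ℝ) → ℝ := fun t =>
    ∑ i ∈ s, (1 / 2 : ℝ) * ∑ j : Fin r, ∑ l : Fin r, t j * t l * (B i (b j : H) (b l : H) : ℝ)
  have hF : Continuous F := by
    refine continuous_finsetSum _ fun i _ => continuous_const.mul ?_
    refine continuous_finsetSum _ fun j _ => continuous_finsetSum _ fun l _ => ?_
    exact ((continuous_apply j).mul (continuous_apply l)).mul continuous_const
  have hF0 : F 0 < 1 := by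
    simp only [F, Pi.zero_apply, zero_mul, Finset.sum_const_zero, mul_zero]
    exact zero_lt_one
  refine fg_of_norm M S b (fun x hx => (hSmem x).1 hx) Nsum F hF hF0 ?_ ?_
  · -- `Nsum ≥ 1` off `0` on `S`
    intro x hx hx0
    obtain ⟨n, hn, hnx⟩ := (hSmem x).1 hx
    have hnx0 : n • x ≠ 0 := smul_ne_zero hn hx0
    obtain ⟨i, hi, h1⟩ := hs (n • x) hnx hnx0
    have h1' : 1 ≤ N i x := (hNB i).one_le_of_one_le_zsmul h1
    calc (1 : ℤ) ≤ N i x := h1'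
      _ ≤ ∑ i ∈ s, N i x := Finset.single_le_sum (fun j _ => (hNB j).nonneg x) hi
  · -- `Nsum x = F (coordinates of x)`
    intro x _ m y hm hmx
    have hy : (y : H) = ∑ j : Fin r, (b.repr y j) • (b j : H) := by
      conv_lhs => rw [← b.sum_repr y]
      simp only [Submodule.coe_sum, Submodule.coe_smul]
    -- `2 m² N i x = 2 N i (m x) = B i y y = Σ_j Σ_l c_j c_l B i b_j b_l`
    have key : ∀ i, (2 * m ^ 2 : ℤ) * N i x =
        ∑ j : Fin r, ∑ l : Fin r, b.repr y j * b.repr y l * B i (b j : H) (b l : H) := fun i => by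
      have h1 : (m ^ 2 : ℤ) * N i x = N i (m • x) := ((hNB i).apply_zsmul m x).symm
      have h2 : 2 * N i (m • x) = B i (y : H) (y : H) := by rw [hmx]; exact (hNB i).two_mul_eq _
      have h3 : B i (y : H) (y : H) =
          ∑ j : Fin r, ∑ l : Fin r, b.repr y j * b.repr y l * B i (b j : H) (b l : H) := by
        conv_lhs => rw [hy]
        simp only [map_sum, map_zsmul, AddMonoidHom.finsetSum_apply, AddMonoidHom.smul_apply,
          smul_eq_mul, Finset.mul_sum]
        refine Finset.sum_congr rfl fun j _ => Finset.sum_congr rfl fun l _ => ?_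
        rw [(hNB i).symm (b l : H) (b j : H)]
        ring
      calc (2 * m ^ 2 : ℤ) * N i x = 2 * (m ^ 2 * N i x) := by ring
        _ = ∑ j : Fin r, ∑ l : Fin r, b.repr y j * b.repr y l * B i (b j : H) (b l : H) := by
          rw [h1, h2, h3]
    have hm' : (m : ℝ) ≠ 0 := Int.cast_ne_zero.2 hm
    simp only [Nsum, F, Int.cast_sum]
    refine Finset.sum_congr rfl fun i _ => ?_
    have k := congrArg (fun z : ℤ => (z : ℝ)) (key i)
    push_cast at k
    have e : (N i x : ℝ) = (1 / (2 * (m : ℝ) ^ 2)) *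
        ∑ j : Fin r, ∑ l : Fin r, (b.repr y j : ℝ) * (b.repr y l : ℝ) * (B i (b j : H) (b l : H) : ℝ) := by
      rw [← k]; field_simp
    rw [e, Finset.mul_sum, Finset.mul_sum]
    refine Finset.sum_congr rfl fun j _ => ?_
    rw [Finset.mul_sum, Finset.mul_sum]
    refine Finset.sum_congr rfl fun l _ => ?_
    field_simp

end PositiveForms

end Literature.NumberTheory.DiophantineGeometry
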